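import Mathlib

/-!
# Part J — the two finite-dimensional inputs (β1) GAP and (β2) SOLVE of ASSEMBLY SPEC A-12 (memo §160), abstractly
over `ι → ℝ` with the dot product.
-/

set_option linter.dupNamespace false
set_option autoImplicit false

open Matrix

namespace Summit.HubbardSuperconductivity.HubbardSuperconductivity.Theorems.AnisotropyChord.Tower

variable {ι : Type} [Fintype ι]

/-- `0 ≤ x ⬝ᵥ x`. [folklore] -/
private theorem dot_self_nonneg (v : ι → ℝ) : 0 ≤ v ⬝ᵥ v :=
  Finset.sum_nonneg fun i _ => mul_self_nonneg (v i)

/-- `x ⬝ᵥ x = 0 ↔ x = 0`. [folklore] -/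
private theorem dot_self_eq_zero {v : ι → ℝ} (h : v ⬝ᵥ v = 0) : v = 0 := by
  funext i
  have h' : ∑ j, v j * v j = 0 := h
  have := (Finset.sum_eq_zero_iff_of_nonneg (fun j _ => mul_self_nonneg (v j))).mp h' i (Finset.mem_univ i)
  simpa using this

/-- the orthogonal complement of `φ₀` as a submodule (kernel of the functional `v ↦ φ₀ ⬝ᵥ v`). -/
def perp (φ₀ : ι → ℝ) : Submodule ℝ (ι → ℝ) where
  carrier := {v | φ₀ ⬝ᵥ v = 0}
  add_mem' := by intro a b ha hb; simp only [Set.mem_setOf_eq, dotProduct_add] at *; rw [ha, hb, add_zero]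
  zero_mem' := by simp
  smul_mem' := by intro c v hv; simp only [Set.mem_setOf_eq, dotProduct_smul, smul_eq_mul] at *; rw [hv, mul_zero]

/-- Membership in the orthogonal complement of `φ₀`. [folklore] -/
theorem mem_perp {φ₀ v : ι → ℝ} : v ∈ perp φ₀ ↔ φ₀ ⬝ᵥ v = 0 := Iff.rfl

/-- **(β2) SOLVE.** A symmetric `A` with `Aφ₀ = 0` whose quadratic form vanishes on `φ₀^⟂` only at `0` is
bijective on `φ₀^⟂`: every `u ⟂ φ₀` is `A v` for a (unique) `v ⟂ φ₀`. -/
theorem solve_on_perp (A : (ι → ℝ) →ₗ[ℝ] (ι → ℝ)) (hA : ∀ f g : ι → ℝ, f ⬝ᵥ A g = A f ⬝ᵥ g)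
    (φ₀ : ι → ℝ) (hAφ₀ : A φ₀ = 0)
    (hker : ∀ χ : ι → ℝ, φ₀ ⬝ᵥ χ = 0 → χ ⬝ᵥ A χ = 0 → χ = 0)
    (u : ι → ℝ) (hu : φ₀ ⬝ᵥ u = 0) :
    ∃ v : ι → ℝ, φ₀ ⬝ᵥ v = 0 ∧ A v = u := by
  -- A maps φ₀^⟂ into φ₀^⟂
  have hmaps : ∀ x ∈ perp φ₀, A x ∈ perp φ₀ := by
    intro x _; rw [mem_perp, hA, hAφ₀, zero_dotProduct]
  let A' : perp φ₀ →ₗ[ℝ] perp φ₀ := A.restrict hmaps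
  have hinj : Function.Injective A' := by
    rw [← LinearMap.ker_eq_bot, LinearMap.ker_eq_bot']
    intro x hx
    have hx' : A (x : ι → ℝ) = 0 := by
      have := congrArg Subtype.val hx
      simpa [A', LinearMap.restrict_apply] using this
    have h0 : (x : ι → ℝ) ⬝ᵥ A (x : ι → ℝ) = 0 := by rw [hx', dotProduct_zero]
    have := hker x x.2 h0
    exact Subtype.ext this
  have hsurj : Function.Surjective A' := LinearMap.surjective_of_injective hinj
  obtain ⟨v, hv⟩ := hsurj ⟨u, hu⟩
  refine ⟨v, v.2, ?_⟩
  have := congrArg Subtype.val hv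
  simpa [A', LinearMap.restrict_apply] using this

/-- **(β1) GAP.** Under the same kernel hypothesis and positivity of the form, there is `γ > 0` with
`γ‖χ‖² ≤ ⟨χ,Aχ⟩` on `φ₀^⟂` (compactness of the unit sphere of `φ₀^⟂` in finite dimension). -/
theorem gap_on_perp (A : (ι → ℝ) →ₗ[ℝ] (ι → ℝ))
    (φ₀ : ι → ℝ) (hpsd : ∀ χ : ι → ℝ, 0 ≤ χ ⬝ᵥ A χ)
    (hker : ∀ χ : ι → ℝ, φ₀ ⬝ᵥ χ = 0 → χ ⬝ᵥ A χ = 0 → χ = 0) :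
    ∃ γ : ℝ, 0 < γ ∧ ∀ χ : ι → ℝ, φ₀ ⬝ᵥ χ = 0 → γ * (χ ⬝ᵥ χ) ≤ χ ⬝ᵥ A χ := by
  classical
  -- the constraint set
  let S : Set (ι → ℝ) := {χ | φ₀ ⬝ᵥ χ = 0 ∧ χ ⬝ᵥ χ = 1}
  have hcont_dot : ∀ w : ι → ℝ, Continuous fun χ : ι → ℝ => w ⬝ᵥ χ := by
    intro w
    simp only [dotProduct]
    exact continuous_finsetSum _ fun i _ => (continuous_const.mul (continuous_apply i))
  have hcont_sq : Continuous fun χ : ι → ℝ => χ ⬝ᵥ χ := by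
    simp only [dotProduct]
    exact continuous_finsetSum _ fun i _ => ((continuous_apply i).mul (continuous_apply i))
  have hcont_q : Continuous fun χ : ι → ℝ => χ ⬝ᵥ A χ := by
    simp only [dotProduct]
    refine continuous_finsetSum _ fun i _ => (continuous_apply i).mul ?_
    exact (continuous_apply i).comp A.continuous_of_finiteDimensional
  have hclosed : IsClosed S := by
    apply IsClosed.inter
    · exact isClosed_eq (hcont_dot φ₀) continuous_const
    · exact isClosed_eq hcont_sq continuous_const
  -- bounded: χ ⬝ χ = 1 ⇒ |χ i| ≤ 1 ⇒ χ ∈ closedBall 0 1 (sup norm)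
  have hsub : S ⊆ Metric.closedBall (0 : ι → ℝ) 1 := by
    intro χ hχ
    rw [mem_closedBall_zero_iff, pi_norm_le_iff_of_nonneg zero_le_one]
    intro i
    rw [Real.norm_eq_abs]
    have h1 : χ i * χ i ≤ χ ⬝ᵥ χ := by
      simp only [dotProduct]
      exact Finset.single_le_sum (f := fun j => χ j * χ j) (fun j _ => mul_self_nonneg (χ j)) (Finset.mem_univ i)
    rw [hχ.2] at h1
    exact abs_le_one_iff_mul_self_le_one.mpr h1
  have hcomp : IsCompact S := (isCompact_closedBall (0 : ι → ℝ) 1).of_isClosed_subset hclosed hsub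
  by_cases hne : S.Nonempty
  · obtain ⟨χ₀, hχ₀S, hmin⟩ := hcomp.exists_isMinOn hne hcont_q.continuousOn
    have hγpos : 0 < χ₀ ⬝ᵥ A χ₀ := by
      rcases (hpsd χ₀).lt_or_eq with h | h
      · exact h
      · exfalso
        have := hker χ₀ hχ₀S.1 h.symm
        have h1 := hχ₀S.2
        rw [this, zero_dotProduct] at h1
        exact zero_ne_one h1
    refine ⟨χ₀ ⬝ᵥ A χ₀, hγpos, fun χ hχ => ?_⟩
    by_cases hχ0 : χ ⬝ᵥ χ = 0
    · rw [hχ0, mul_zero]; exact hpsd χ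
    · -- normalise: χ = r • ξ with ξ ∈ S, r² = χ ⬝ χ
      have hpos : 0 < χ ⬝ᵥ χ := lt_of_le_of_ne (dot_self_nonneg χ) (Ne.symm hχ0)
      set r := Real.sqrt (χ ⬝ᵥ χ) with hr
      have hrpos : 0 < r := Real.sqrt_pos.mpr hpos
      have hr2 : r ^ 2 = χ ⬝ᵥ χ := Real.sq_sqrt hpos.le
      let ξ : ι → ℝ := r⁻¹ • χ
      have hξS : ξ ∈ S := by
        constructor
        · show φ₀ ⬝ᵥ (r⁻¹ • χ) = 0
          rw [dotProduct_smul, hχ, smul_zero]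
        · show (r⁻¹ • χ) ⬝ᵥ (r⁻¹ • χ) = 1
          rw [smul_dotProduct, dotProduct_smul, smul_eq_mul, smul_eq_mul, ← hr2]
          field_simp
      have hle := hmin hξS
      simp only [Set.mem_setOf_eq] at hle
      -- hle : χ₀ ⬝ A χ₀ ≤ ξ ⬝ A ξ = r⁻² χ ⬝ A χ
      have hξq : ξ ⬝ᵥ A ξ = r⁻¹ * r⁻¹ * (χ ⬝ᵥ A χ) := by
        show (r⁻¹ • χ) ⬝ᵥ A (r⁻¹ • χ) = _
        rw [map_smul, smul_dotProduct, dotProduct_smul, smul_eq_mul, smul_eq_mul]; ring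
      rw [hξq] at hle
      rw [← hr2]
      have hrr : r ^ 2 * (r⁻¹ * r⁻¹ * (χ ⬝ᵥ A χ)) = χ ⬝ᵥ A χ := by field_simp
      calc χ₀ ⬝ᵥ A χ₀ * r ^ 2 = r ^ 2 * (χ₀ ⬝ᵥ A χ₀) := by ring
        _ ≤ r ^ 2 * (r⁻¹ * r⁻¹ * (χ ⬝ᵥ A χ)) := mul_le_mul_of_nonneg_left hle (sq_nonneg r)
        _ = χ ⬝ᵥ A χ := hrr
  · -- S empty: every χ ⟂ φ₀ is 0 (else normalise), so γ = 1 works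
    refine ⟨1, one_pos, fun χ hχ => ?_⟩
    by_cases hχ0 : χ ⬝ᵥ χ = 0
    · rw [hχ0, mul_zero]; exact hpsd χ
    · exfalso; apply hne
      have hpos : 0 < χ ⬝ᵥ χ := lt_of_le_of_ne (dot_self_nonneg χ) (Ne.symm hχ0)
      set r := Real.sqrt (χ ⬝ᵥ χ) with hr
      have hr2 : r ^ 2 = χ ⬝ᵥ χ := Real.sq_sqrt hpos.le
      have hrpos : 0 < r := Real.sqrt_pos.mpr hpos
      refine ⟨r⁻¹ • χ, ?_, ?_⟩
      · show φ₀ ⬝ᵥ (r⁻¹ • χ) = 0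
        rw [dotProduct_smul, hχ, smul_zero]
      · show (r⁻¹ • χ) ⬝ᵥ (r⁻¹ • χ) = 1
        rw [smul_dotProduct, dotProduct_smul, smul_eq_mul, smul_eq_mul, ← hr2]
        field_simp

/-- **UNIQUENESS near the ferromagnet** (for the `M = M'` case of `TotalSpinMonotoneNearFM` and for fixing THE sector
ground state): two eigenvectors of `A + ηW` with the same eigenvalue `e < γ − η·w_max` are parallel —
`(φ₀·ψ₂)ψ₁ = (φ₀·ψ₁)ψ₂` (the combination orthogonal to `φ₀` is an eigenvector in `φ₀^⟂`, where the form is `≥ γ − η w_max`). -/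
theorem eigen_parallel_of_gap (A W : (ι → ℝ) →ₗ[ℝ] (ι → ℝ)) (φ₀ ψ₁ ψ₂ : ι → ℝ) (η e γ wmax : ℝ)
    (hgap : ∀ χ : ι → ℝ, φ₀ ⬝ᵥ χ = 0 → γ * (χ ⬝ᵥ χ) ≤ χ ⬝ᵥ A χ)
    (hWb : ∀ x : ι → ℝ, |x ⬝ᵥ W x| ≤ wmax * (x ⬝ᵥ x)) (hη : 0 ≤ η)
    (h1 : A ψ₁ + η • W ψ₁ = e • ψ₁) (h2 : A ψ₂ + η • W ψ₂ = e • ψ₂) (he : e < γ - η * wmax) :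
    (φ₀ ⬝ᵥ ψ₂) • ψ₁ = (φ₀ ⬝ᵥ ψ₁) • ψ₂ := by
  set v : ι → ℝ := (φ₀ ⬝ᵥ ψ₂) • ψ₁ - (φ₀ ⬝ᵥ ψ₁) • ψ₂ with hv
  have h0v : φ₀ ⬝ᵥ v = 0 := by
    simp only [hv, dotProduct_sub, dotProduct_smul, smul_eq_mul]; ring
  have heig : A v + η • W v = e • v := by
    have e1 : A v + η • W v = (φ₀ ⬝ᵥ ψ₂) • (A ψ₁ + η • W ψ₁) - (φ₀ ⬝ᵥ ψ₁) • (A ψ₂ + η • W ψ₂) := by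
      simp only [hv, map_sub, map_smul, smul_sub, smul_add]
      rw [smul_comm η (φ₀ ⬝ᵥ ψ₂), smul_comm η (φ₀ ⬝ᵥ ψ₁)]
      abel
    rw [e1, h1, h2, hv, smul_sub, smul_comm (φ₀ ⬝ᵥ ψ₂) e, smul_comm (φ₀ ⬝ᵥ ψ₁) e]
  have hq : v ⬝ᵥ A v + η * (v ⬝ᵥ W v) = e * (v ⬝ᵥ v) := by
    have := congrArg (fun w => v ⬝ᵥ w) heig
    simp only [dotProduct_add, dotProduct_smul, smul_eq_mul] at this
    exact this
  have hA := hgap v h0v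
  have hW := (abs_le.mp (hWb v)).1
  have hvv : 0 ≤ v ⬝ᵥ v := dot_self_nonneg v
  -- (γ − η wmax − e) ‖v‖² ≤ 0
  have hle : (γ - η * wmax - e) * (v ⬝ᵥ v) ≤ 0 := by
    have := mul_le_mul_of_nonneg_left hW hη
    nlinarith
  have hvz : v ⬝ᵥ v = 0 := by
    by_contra hne
    have hpos : 0 < v ⬝ᵥ v := lt_of_le_of_ne hvv (Ne.symm hne)
    have : 0 < (γ - η * wmax - e) * (v ⬝ᵥ v) := mul_pos (by linarith) hpos
    linarith
  have := dot_self_eq_zero hvz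
  rw [hv] at this
  exact sub_eq_zero.mp this

end Summit.HubbardSuperconductivity.HubbardSuperconductivity.Theorems.AnisotropyChord.Tower
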